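import Summits.FinalStateConjecture.FinalStateConjecture.Theorems.EIHFluxBalanceInertialRecessionStubHigherOrderVariation
import Summits.FinalStateConjecture.FinalStateConjecture.Theorems.EIHFluxBalanceInertialRecessionStubHigherOrderSummands
import Summits.FinalStateConjecture.FinalStateConjecture.Theorems.EIHFluxBalanceInertialRecessionStubHigherOrderHoleCore
import Summits.FinalStateConjecture.FinalStateConjecture.Theorems.EIHFluxBalanceInertialRecessionStubHigherOrderOwnTerm

/-!
# Route EIHFluxBalance — `InertialRecession` (E′), line `SketchCleanExcision`, skeleton r13,
# stub `stub_higherOrderSlaving` (EF): the jets and lab-time variations of ONE painted summand at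
# a slice point, in terms of the visible sizes of its hole

Helper file for the crux `stmt-FinalStateConjecture-17403`
(`Summit.FinalStateConjecture.FinalStateConjecture.Theses.EIHFluxBalance.InertialRecession`, E′),
registered stub `stub_higherOrderSlaving` (orders two and three of frozen-vacuum slaving).

`higherOrder_summandAt`: for a painted summand `s ↦ boostedKerrBilin (Λ s) (s, ξ s) M a` with a
representative frame `Λ̃` and the per-hole package clause of `…StubHigherOrderHolePackage`
(hypothesis `hpack`), at a slice point `x` (`x⁰ = t`) whose scaled rest position
`(a/ρ, Λ̃(t)⁻¹, (x − c(t))/ρ)` lies in a compact parameter box, the frozen summand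
`F₀ = boostedKerrBilin (Λ t) (c t) M a − η` and the variations `P_m = ∂ₛᵐ[boostedKerrBilin …](t)`
(`m ≤ 3`) obey, with `K = (|M|/ρ) C Q⁴`:
`‖DᵏF₀(x)‖ ≤ K`, `‖DᵏP₁(x)‖ ≤ K E₁`, `‖P₂(x)‖, ‖DP₂(x)‖ ≤ K (E₂ + 2E₁)`,
`‖P₃(x)‖ ≤ 5K (E₃ + E₂ + E₁)` (variation bounds of `…StubHigherOrderVariation` in the scaled
master-function form `…StubHigherOrderSummands`, and the package bounds `q₁ ≤ Q E₁`, …).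

No definitions, no named facts, no `sorry`.
-/

set_option linter.dupNamespace false
set_option maxSynthPendingDepth 6
set_option synthInstance.maxHeartbeats 200000

noncomputable section

namespace Summit.FinalStateConjecture.FinalStateConjecture.Theorems.SublinearIsFree.Slaving

open scoped Topology ContDiff BigOperators
open Filter Set Function Literature.Geometry.Lorentzian
  Summit.FinalStateConjecture.FinalStateConjecture.Theorems

set_option maxHeartbeats 6400000 in
/-- **One painted summand at a slice point.** See the module docstring. [folklore] -/
theorem higherOrder_summandAt (α₀ γb R' : ℝ) {r₁ : ℝ} (hr₁ : 0 < r₁) :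
    ∃ C : ℝ, 0 ≤ C ∧ ∀ (Λ Λ' : ℝ → lorentzGroup) (ξ : ℝ → E3) (M a Q : ℝ) (t : ℝ) (x : E4) (ρ : ℝ),
      ContDiff ℝ ∞ (fun s ↦ ((Λ' s : E4 ≃L[ℝ] E4) : E4 →L[ℝ] E4)) →
      (∀ t : ℝ, let F : ℝ → E4 →L[ℝ] E4 := fun s ↦ ((Λ' s : E4 ≃L[ℝ] E4) : E4 →L[ℝ] E4); let S : ℝ → E4 →L[ℝ] E4 := fun s ↦ (((Λ' s : E4 ≃L[ℝ] E4).symm : E4 ≃L[ℝ] E4) : E4 →L[ℝ] E4); let A : ℝ → E4 →L[ℝ] E4 := fun s ↦ (deriv S s).comp (F s); let u : ℝ → E4 := fun s ↦ (Λ s : E4 ≃L[ℝ] E4) (E4.basisVector 0); let n : ℝ → E4 := fun s ↦ (Λ s : E4 ≃L[ℝ] E4) (E4.basisVector 3); let μ : ℝ → E3 := fun s ↦ deriv ξ s - ((u s) 0)⁻¹ • E4.spatial (u s); let cc : ℝ → E4 := fun s ↦ E4.ofTimeSpace s (ξ s) - ((s - t) * (u t 0)⁻¹) • u s; let E₁ :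 ℝ := ‖deriv u t‖ + ‖μ t‖ + (if a = 0 then 0 else ‖deriv n t‖); let E₂ : ℝ := ‖iteratedDeriv 2 u t‖ + ‖deriv μ t‖ + (if a = 0 then 0 else ‖iteratedDeriv 2 n t‖); let E₃ : ℝ := ‖iteratedDeriv 3 u t‖ + ‖iteratedDeriv 2 μ t‖ + (if a = 0 then 0 else ‖iteratedDeriv 3 n t‖); ‖F t‖ ≤ Q ∧ ‖S t‖ ≤ Q ∧ (ContDiff ℝ ((⊤ : ℕ∞) : WithTop ℕ∞) cc ∧ cc t = E4.ofTimeSpace t (ξ t) ∧ deriv cc t = E4.spaceEmbed (μ t) ∧ ∀ (M s : ℝ) (z : E4), boostedKerrBilin (Λ s) (E4.ofTimeSpace s (ξ s)) M a z = boostedKerrBilin (Λ' s) (cc s) M a z) ∧ ‖deriv S t‖ + ‖deriv cc t‖ ≤ Q * E₁ ∧ (E₁ ≤ 1 → ‖iteratedDeriv 2 S t‖ + ‖iteratedDeriv 2 cc t‖ ≤ Q * (E₂ + E₁)) ∧ (E₁ ≤ 1 → E₂ ≤ 1 → ‖iteratedDeriv 3 S t‖ + ‖iteratedDeriv 3 cc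 t‖ ≤ Q * (E₃ + E₂ + E₁)) ∧ ‖A t‖ ≤ Q * E₁ ∧ (E₁ ≤ 1 → ‖deriv A t‖ ≤ Q * (E₂ + E₁)) ∧ (E₁ ≤ 1 → E₂ ≤ Q * ((‖deriv A t (E4.basisVector 0)‖ + ‖E4.spatial (S t (-(iteratedDeriv 2 cc t)))‖ + ‖a • deriv A t (E4.basisVector 3)‖) + E₁)) ∧ (E₁ ≤ 1 → E₂ ≤ 1 → E₃ ≤ Q * ((‖iteratedDeriv 2 A t (E4.basisVector 0)‖ + ‖E4.spatial (S t (-(iteratedDeriv 3 cc t)))‖ + ‖a • iteratedDeriv 2 A t (E4.basisVector 3)‖) + E₂ + E₁))) →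
      1 ≤ Q → 1 ≤ ρ → x 0 = t →
      ((ρ⁻¹ * a, (((Λ' t : E4 ≃L[ℝ] E4).symm : E4 ≃L[ℝ] E4) : E4 →L[ℝ] E4),
        ρ⁻¹ • (x - E4.ofTimeSpace t (ξ t))) : ℝ × (E4 →L[ℝ] E4) × E4) ∈ {p : ℝ × (E4 →L[ℝ] E4) × E4 | |p.1| ≤ α₀ ∧ ((∀ v w, Minkowski.bilin (p.2.1 v) (p.2.1 w) = Minkowski.bilin v w) ∧ |p.2.1 (E4.basisVector 0) 0| ≤ γb) ∧ ‖p.2.2‖ ≤ R' ∧ r₁ ≤ Kerr.radius p.1 (p.2.1 p.2.2)} →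
      let u : ℝ → E4 := fun s ↦ (Λ s : E4 ≃L[ℝ] E4) (E4.basisVector 0)
      let n : ℝ → E4 := fun s ↦ (Λ s : E4 ≃L[ℝ] E4) (E4.basisVector 3)
      let μ : ℝ → E3 := fun s ↦ deriv ξ s - ((u s) 0)⁻¹ • E4.spatial (u s)
      let E₁ : ℝ := ‖deriv u t‖ + ‖μ t‖ + (if a = 0 then 0 else ‖deriv n t‖)
      let E₂ : ℝ := ‖iteratedDeriv 2 u t‖ + ‖deriv μ t‖ + (if a = 0 then 0 else ‖iteratedDeriv 2 n t‖)
      let E₃ : ℝ := ‖iteratedDeriv 3 u t‖ + ‖iteratedDeriv 2 μ t‖ +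
        (if a = 0 then 0 else ‖iteratedDeriv 3 n t‖)
      let F₀ : E4 → E4 →L[ℝ] E4 →L[ℝ] ℝ := fun z ↦
        boostedKerrBilin (Λ t) (E4.ofTimeSpace t (ξ t)) M a z - Minkowski.bilin
      let P₁ : E4 → E4 →L[ℝ] E4 →L[ℝ] ℝ := fun z ↦
        deriv (fun s ↦ boostedKerrBilin (Λ s) (E4.ofTimeSpace s (ξ s)) M a z) t
      let P₂ : E4 → E4 →L[ℝ] E4 →L[ℝ] ℝ := fun z ↦
        iteratedDeriv 2 (fun s ↦ boostedKerrBilin (Λ s) (E4.ofTimeSpace s (ξ s)) M a z) t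
      let P₃ : E4 → E4 →L[ℝ] E4 →L[ℝ] ℝ := fun z ↦
        iteratedDeriv 3 (fun s ↦ boostedKerrBilin (Λ s) (E4.ofTimeSpace s (ξ s)) M a z) t
      E₁ ≤ 1 →
      (‖F₀ x‖ ≤ |M| / ρ * C * Q ^ 4 ∧ ‖fderiv ℝ F₀ x‖ ≤ |M| / ρ * C * Q ^ 4 ∧
        ‖fderiv ℝ (fderiv ℝ F₀) x‖ ≤ |M| / ρ * C * Q ^ 4 ∧
        ‖fderiv ℝ (fderiv ℝ (fderiv ℝ F₀)) x‖ ≤ |M| / ρ * C * Q ^ 4) ∧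
      (‖P₁ x‖ ≤ |M| / ρ * C * Q ^ 4 * E₁ ∧ ‖fderiv ℝ P₁ x‖ ≤ |M| / ρ * C * Q ^ 4 * E₁ ∧
        ‖fderiv ℝ (fderiv ℝ P₁) x‖ ≤ |M| / ρ * C * Q ^ 4 * E₁) ∧
      (‖P₂ x‖ ≤ |M| / ρ * C * Q ^ 4 * (E₂ + 2 * E₁) ∧
        ‖fderiv ℝ P₂ x‖ ≤ |M| / ρ * C * Q ^ 4 * (E₂ + 2 * E₁)) ∧
      (E₂ ≤ 1 → ‖P₃ x‖ ≤ |M| / ρ * C * Q ^ 4 * (5 * (E₃ + E₂ + E₁))) := by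
  obtain ⟨C, hC0, hvar⟩ := higherOrder_variation_bounds α₀ γb R' hr₁
  refine ⟨C, hC0, fun Λ Λ' ξ M a Q t x ρ hΛ's hpack hQ1 hρ hx0 hbox ↦ ?_⟩
  intro u n μ E₁ E₂ E₃ F₀ P₁ P₂ P₃ hE₁
  -- the package at `t`
  obtain ⟨-, -, ⟨hccs, hcct, -, hcp⟩, hq₁, hq₂, hq₃, -, -, -, -⟩ := hpack t
  set S : ℝ → E4 →L[ℝ] E4 := fun s ↦ (((Λ' s : E4 ≃L[ℝ] E4).symm : E4 ≃L[ℝ] E4) : E4 →L[ℝ] E4) with hSdef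
  set cc : ℝ → E4 := fun s ↦ E4.ofTimeSpace s (ξ s) - ((s - t) * (u t 0)⁻¹) • u s with hccdef
  have hS : ContDiff ℝ ∞ S := contDiff_lorentz_symm hΛ's
  have hρ0 : 0 < ρ := one_pos.trans_le hρ
  have hbox' : ((ρ⁻¹ * a, S t, ρ⁻¹ • (x - cc t)) : ℝ × (E4 →L[ℝ] E4) × E4) ∈ {p : ℝ × (E4 →L[ℝ] E4) × E4 | |p.1| ≤ α₀ ∧ ((∀ v w, Minkowski.bilin (p.2.1 v) (p.2.1 w) = Minkowski.bilin v w) ∧ |p.2.1 (E4.basisVector 0) 0| ≤ γb) ∧ ‖p.2.2‖ ≤ R' ∧ r₁ ≤ Kerr.radius p.1 (p.2.1 p.2.2)} := by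
    rw [hcct]; exact hbox
  -- the variation bounds for the scaled master-function form
  have hv := hvar M a ρ S cc t x hρ hS hccs hbox'
  obtain ⟨⟨a0, a1, a2, a3⟩, ⟨b1, b2, b3⟩, ⟨-, c2, c3⟩, ⟨-, d2⟩⟩ := hv
  -- the summand in scaled master-function form
  have hform : ∀ s z, boostedKerrBilin (Λ s) (E4.ofTimeSpace s (ξ s)) M a z = Minkowski.bilin +
      (M / ρ) • (fun p : ℝ × (E4 →L[ℝ] E4) × E4 ↦ (Kerr.bilin 1 p.1 (p.2.1 p.2.2) - Minkowski.bilin).bilinearComp p.2.1 p.2.1) (ρ⁻¹ * a, S s, ρ⁻¹ • (z - cc s)) := fun s z ↦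
    higherOrder_summand_omegaForm Λ Λ' ξ cc M a hρ0 (hcp M) s z
  have hF₀ : F₀ = fun z ↦ (M / ρ) • (fun p : ℝ × (E4 →L[ℝ] E4) × E4 ↦ (Kerr.bilin 1 p.1 (p.2.1 p.2.2) - Minkowski.bilin).bilinearComp p.2.1 p.2.1) (ρ⁻¹ * a, S t, ρ⁻¹ • (z - cc t)) := by
    funext z; show boostedKerrBilin (Λ t) (E4.ofTimeSpace t (ξ t)) M a z - Minkowski.bilin = _
    rw [hform t z, add_sub_cancel_left]
  have hP₁ : P₁ = fun z ↦ deriv (fun s ↦ (M / ρ) • (fun p : ℝ × (E4 →L[ℝ] E4) × E4 ↦ (Kerr.bilin 1 p.1 (p.2.1 p.2.2) - Minkowski.bilin).bilinearComp p.2.1 p.2.1) (ρ⁻¹ * a, S s, ρ⁻¹ • (z - cc s))) t := by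
    funext z
    show deriv (fun s ↦ boostedKerrBilin (Λ s) (E4.ofTimeSpace s (ξ s)) M a z) t = _
    simp only [hform]
    exact deriv_const_add _
  have hP₂ : P₂ = fun z ↦ iteratedDeriv 2 (fun s ↦ (M / ρ) • (fun p : ℝ × (E4 →L[ℝ] E4) × E4 ↦ (Kerr.bilin 1 p.1 (p.2.1 p.2.2) - Minkowski.bilin).bilinearComp p.2.1 p.2.1) (ρ⁻¹ * a, S s, ρ⁻¹ • (z - cc s))) t := by
    funext z
    show iteratedDeriv 2 (fun s ↦ boostedKerrBilin (Λ s) (E4.ofTimeSpace s (ξ s)) M a z) t = _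
    simp only [hform]
    exact iteratedDeriv_const_add (by norm_num) _
  have hP₃ : P₃ = fun z ↦ iteratedDeriv 3 (fun s ↦ (M / ρ) • (fun p : ℝ × (E4 →L[ℝ] E4) × E4 ↦ (Kerr.bilin 1 p.1 (p.2.1 p.2.2) - Minkowski.bilin).bilinearComp p.2.1 p.2.1) (ρ⁻¹ * a, S s, ρ⁻¹ • (z - cc s))) t := by
    funext z
    show iteratedDeriv 3 (fun s ↦ boostedKerrBilin (Λ s) (E4.ofTimeSpace s (ξ s)) M a z) t = _
    simp only [hform]
    exact iteratedDeriv_const_add (by norm_num) _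
  -- sizes
  have hE₁0 : 0 ≤ E₁ := by positivity
  have hE₂0 : 0 ≤ E₂ := by positivity
  have hE₃0 : 0 ≤ E₃ := by positivity
  have hQ0 : 0 ≤ Q := zero_le_one.trans hQ1
  have hK0 : 0 ≤ |M| / ρ * C := by positivity
  have hQ4 : 1 ≤ Q ^ 4 := one_le_pow₀ hQ1
  have hQ14 : Q ≤ Q ^ 4 := le_self_pow₀ hQ1 (by norm_num)
  have hQ24 : Q ^ 2 ≤ Q ^ 4 := pow_le_pow_right₀ hQ1 (by norm_num)
  have hQ34 : Q ^ 3 ≤ Q ^ 4 := pow_le_pow_right₀ hQ1 (by norm_num)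
  set q₁ : ℝ := ‖deriv S t‖ + ‖deriv cc t‖ with hq₁def
  set q₂ : ℝ := ‖iteratedDeriv 2 S t‖ + ‖iteratedDeriv 2 cc t‖ with hq₂def
  set q₃ : ℝ := ‖iteratedDeriv 3 S t‖ + ‖iteratedDeriv 3 cc t‖ with hq₃def
  have hq₁0 : 0 ≤ q₁ := by positivity
  have hq₂0 : 0 ≤ q₂ := by positivity
  have h1 : q₁ ≤ Q * E₁ := hq₁
  have h2 : q₂ ≤ Q * (E₂ + E₁) := hq₂ hE₁
  have hq₁1 : q₁ ≤ Q := h1.trans (mul_le_of_le_one_right hQ0 hE₁)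
  -- `q₁² ≤ Q² E₁`, `q₂ + q₁² ≤ Q⁴ (E₂ + 2E₁)`
  have hsq : q₁ ^ 2 ≤ Q ^ 2 * E₁ := by
    calc q₁ ^ 2 = q₁ * q₁ := sq q₁
      _ ≤ Q * (Q * E₁) := mul_le_mul hq₁1 h1 hq₁0 hQ0
      _ = Q ^ 2 * E₁ := by ring
  have h22 : q₂ + q₁ ^ 2 ≤ Q ^ 4 * (E₂ + 2 * E₁) := by
    have k1 : Q * (E₂ + E₁) ≤ Q ^ 4 * (E₂ + E₁) := mul_le_mul_of_nonneg_right hQ14 (by positivity)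
    have k2 : Q ^ 2 * E₁ ≤ Q ^ 4 * E₁ := mul_le_mul_of_nonneg_right hQ24 hE₁0
    nlinarith only [h2, hsq, k1, k2]
  refine ⟨⟨?_, ?_, ?_, ?_⟩, ⟨?_, ?_, ?_⟩, ⟨?_, ?_⟩, fun hE₂ ↦ ?_⟩
  · rw [hF₀]; exact a0.trans (le_mul_of_one_le_right hK0 hQ4)
  · rw [hF₀]; exact a1.trans (le_mul_of_one_le_right hK0 hQ4)
  · rw [hF₀]; exact a2.trans (le_mul_of_one_le_right hK0 hQ4)
  · rw [hF₀]; exact a3.trans (le_mul_of_one_le_right hK0 hQ4)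
  · rw [hP₁]
    refine b1.trans ?_
    rw [mul_assoc (|M| / ρ * C)]
    exact mul_le_mul_of_nonneg_left (h1.trans (mul_le_mul_of_nonneg_right hQ14 hE₁0)) hK0
  · rw [hP₁]
    refine b2.trans ?_
    rw [mul_assoc (|M| / ρ * C)]
    exact mul_le_mul_of_nonneg_left (h1.trans (mul_le_mul_of_nonneg_right hQ14 hE₁0)) hK0
  · rw [hP₁]
    refine b3.trans ?_
    rw [mul_assoc (|M| / ρ * C)]
    exact mul_le_mul_of_nonneg_left (h1.trans (mul_le_mul_of_nonneg_right hQ14 hE₁0)) hK0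
  · rw [hP₂]
    refine c2.trans ?_
    rw [mul_assoc (|M| / ρ * C)]
    exact mul_le_mul_of_nonneg_left h22 hK0
  · rw [hP₂]
    refine c3.trans ?_
    rw [mul_assoc (|M| / ρ * C)]
    exact mul_le_mul_of_nonneg_left h22 hK0
  · rw [hP₃]
    refine d2.trans ?_
    rw [mul_assoc (|M| / ρ * C)]
    refine mul_le_mul_of_nonneg_left ?_ hK0
    have h3 : q₃ ≤ Q * (E₃ + E₂ + E₁) := hq₃ hE₁ hE₂
    have k1 : Q * (E₃ + E₂ + E₁) ≤ Q ^ 4 * (E₃ + E₂ + E₁) := mul_le_mul_of_nonneg_right hQ14 (by positivity)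
    have k2 : 3 * q₂ * q₁ ≤ 3 * (Q ^ 4 * (E₂ + E₁)) := by
      have j1 : q₂ * q₁ ≤ (Q * (E₂ + E₁)) * Q := mul_le_mul h2 hq₁1 hq₁0 (by positivity)
      have j2 : (Q * (E₂ + E₁)) * Q ≤ Q ^ 4 * (E₂ + E₁) := by
        rw [show (Q * (E₂ + E₁)) * Q = Q ^ 2 * (E₂ + E₁) by ring]
        exact mul_le_mul_of_nonneg_right hQ24 (by positivity)
      nlinarith only [j1, j2]
    have k3 : q₁ ^ 3 ≤ Q ^ 4 * E₁ := by
      calc q₁ ^ 3 = q₁ ^ 2 * q₁ := by ring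
        _ ≤ (Q ^ 2 * E₁) * Q := mul_le_mul hsq hq₁1 hq₁0 (by positivity)
        _ = Q ^ 3 * E₁ := by ring
        _ ≤ Q ^ 4 * E₁ := mul_le_mul_of_nonneg_right hQ34 hE₁0
    have k4 : 0 ≤ Q ^ 4 * E₃ := by positivity
    have k5 : 0 ≤ Q ^ 4 * E₂ := by positivity
    nlinarith only [h3, k1, k2, k3, k4, k5]


set_option maxHeartbeats 6400000 in
/-- **The own hole: the leading variations are the coercivity variation forms up to terms that
are small with the first-order sizes.** With `ρ = 1` and the notation of `higherOrder_summandAt`: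
`‖P₂(x) − W₂‖ ≤ 2|M| C Q⁴ E₁` and (if `E₂ ≤ 1`) `‖P₃(x) − W₃‖ ≤ 14|M| C Q⁴ E₁`, where
`W_k = Var(Λ̃(t), A⁽ᵏ⁻¹⁾(t), Λ̃(t)⁻¹(−c̃⁽ᵏ⁾(t)))` at `x − c(t)` (`…StubHigherOrderOwnTerm`).
[folklore] -/
theorem higherOrder_summandAt_own (α₀ γb R' : ℝ) {r₁ : ℝ} (hr₁ : 0 < r₁) :
    ∃ C : ℝ, 0 ≤ C ∧ ∀ (Λ Λ' : ℝ → lorentzGroup) (ξ : ℝ → E3) (M a Q : ℝ) (t : ℝ) (x : E4),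
      ContDiff ℝ ∞ (fun s ↦ ((Λ' s : E4 ≃L[ℝ] E4) : E4 →L[ℝ] E4)) →
      (∀ t : ℝ, let F : ℝ → E4 →L[ℝ] E4 := fun s ↦ ((Λ' s : E4 ≃L[ℝ] E4) : E4 →L[ℝ] E4); let S : ℝ → E4 →L[ℝ] E4 := fun s ↦ (((Λ' s : E4 ≃L[ℝ] E4).symm : E4 ≃L[ℝ] E4) : E4 →L[ℝ] E4); let A : ℝ → E4 →L[ℝ] E4 := fun s ↦ (deriv S s).comp (F s); let u : ℝ → E4 := fun s ↦ (Λ s : E4 ≃L[ℝ] E4) (E4.basisVector 0); let n : ℝ → E4 := fun s ↦ (Λ s : E4 ≃L[ℝ] E4) (E4.basisVector 3); let μ : ℝ → E3 := fun s ↦ deriv ξ s - ((u s) 0)⁻¹ • E4.spatial (u s); let cc : ℝ → E4 := fun s ↦ E4.ofTimeSpace s (ξ s) - ((s - t) * (u t 0)⁻¹) • u s; let E₁ : ℝ := ‖deriv u t‖ + ‖μ t‖ + (if a = 0 then 0 else ‖deriv n t‖); let E₂ : ℝ := ‖iteratedDeriv 2 u t‖ + ‖deriv μ t‖ + (if a =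 0 then 0 else ‖iteratedDeriv 2 n t‖); let E₃ : ℝ := ‖iteratedDeriv 3 u t‖ + ‖iteratedDeriv 2 μ t‖ + (if a = 0 then 0 else ‖iteratedDeriv 3 n t‖); ‖F t‖ ≤ Q ∧ ‖S t‖ ≤ Q ∧ (ContDiff ℝ ((⊤ : ℕ∞) : WithTop ℕ∞) cc ∧ cc t = E4.ofTimeSpace t (ξ t) ∧ deriv cc t = E4.spaceEmbed (μ t) ∧ ∀ (M s : ℝ) (z : E4), boostedKerrBilin (Λ s) (E4.ofTimeSpace s (ξ s)) M a z = boostedKerrBilin (Λ' s) (cc s) M a z) ∧ ‖deriv S t‖ + ‖deriv cc t‖ ≤ Q * E₁ ∧ (E₁ ≤ 1 → ‖iteratedDeriv 2 S t‖ + ‖iteratedDeriv 2 cc t‖ ≤ Q * (E₂ + E₁)) ∧ (E₁ ≤ 1 → E₂ ≤ 1 → ‖iteratedDeriv 3 S t‖ + ‖iteratedDeriv 3 cc t‖ ≤ Q * (E₃ + E₂ + E₁)) ∧ ‖A t‖ ≤ Q * E₁ ∧ (E₁ ≤ 1 → ‖deriv A t‖ ≤ Q * (E₂ + E₁)) ∧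 (E₁ ≤ 1 → E₂ ≤ Q * ((‖deriv A t (E4.basisVector 0)‖ + ‖E4.spatial (S t (-(iteratedDeriv 2 cc t)))‖ + ‖a • deriv A t (E4.basisVector 3)‖) + E₁)) ∧ (E₁ ≤ 1 → E₂ ≤ 1 → E₃ ≤ Q * ((‖iteratedDeriv 2 A t (E4.basisVector 0)‖ + ‖E4.spatial (S t (-(iteratedDeriv 3 cc t)))‖ + ‖a • iteratedDeriv 2 A t (E4.basisVector 3)‖) + E₂ + E₁))) →
      1 ≤ Q → x 0 = t →
      ((a, (((Λ' t : E4 ≃L[ℝ] E4).symm : E4 ≃L[ℝ] E4) : E4 →L[ℝ] E4), x - E4.ofTimeSpace t (ξ t)) :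
        ℝ × (E4 →L[ℝ] E4) × E4) ∈ {p : ℝ × (E4 →L[ℝ] E4) × E4 | |p.1| ≤ α₀ ∧ ((∀ v w, Minkowski.bilin (p.2.1 v) (p.2.1 w) = Minkowski.bilin v w) ∧ |p.2.1 (E4.basisVector 0) 0| ≤ γb) ∧ ‖p.2.2‖ ≤ R' ∧ r₁ ≤ Kerr.radius p.1 (p.2.1 p.2.2)} →
      let F : ℝ → E4 →L[ℝ] E4 := fun s ↦ ((Λ' s : E4 ≃L[ℝ] E4) : E4 →L[ℝ] E4)
      let S : ℝ → E4 →L[ℝ] E4 := fun s ↦ (((Λ' s : E4 ≃L[ℝ] E4).symm : E4 ≃L[ℝ] E4) : E4 →L[ℝ] E4)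
      let A : ℝ → E4 →L[ℝ] E4 := fun s ↦ (deriv S s).comp (F s)
      let u : ℝ → E4 := fun s ↦ (Λ s : E4 ≃L[ℝ] E4) (E4.basisVector 0)
      let n : ℝ → E4 := fun s ↦ (Λ s : E4 ≃L[ℝ] E4) (E4.basisVector 3)
      let μ : ℝ → E3 := fun s ↦ deriv ξ s - ((u s) 0)⁻¹ • E4.spatial (u s)
      let cc : ℝ → E4 := fun s ↦ E4.ofTimeSpace s (ξ s) - ((s - t) * (u t 0)⁻¹) • u s
      let E₁ : ℝ := ‖deriv u t‖ + ‖μ t‖ + (if a = 0 then 0 else ‖deriv n t‖)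
      let E₂ : ℝ := ‖iteratedDeriv 2 u t‖ + ‖deriv μ t‖ + (if a = 0 then 0 else ‖iteratedDeriv 2 n t‖)
      let P₂ : E4 → E4 →L[ℝ] E4 →L[ℝ] ℝ := fun z ↦
        iteratedDeriv 2 (fun s ↦ boostedKerrBilin (Λ s) (E4.ofTimeSpace s (ξ s)) M a z) t
      let P₃ : E4 → E4 →L[ℝ] E4 →L[ℝ] ℝ := fun z ↦
        iteratedDeriv 3 (fun s ↦ boostedKerrBilin (Λ s) (E4.ofTimeSpace s (ξ s)) M a z) t
      E₁ ≤ 1 →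
      ‖P₂ x - ((fderiv ℝ (Kerr.bilin M a) (poincareInv (Λ' t) 0 (x - E4.ofTimeSpace t (ξ t))) (deriv A t (poincareInv (Λ' t) 0 (x - E4.ofTimeSpace t (ξ t))) + S t (-(iteratedDeriv 2 cc t)))).bilinearComp ((((Λ' t) : E4 ≃L[ℝ] E4).symm : E4 →L[ℝ] E4)) ((((Λ' t) : E4 ≃L[ℝ] E4).symm : E4 →L[ℝ] E4)) + (Kerr.bilin M a (poincareInv (Λ' t) 0 (x - E4.ofTimeSpace t (ξ t)))).bilinearComp ((deriv A t).comp ((((Λ' t) : E4 ≃L[ℝ] E4).symm : E4 →L[ℝ] E4))) ((((Λ' t) : E4 ≃L[ℝ] E4).symm : E4 →L[ℝ] E4)) + (Kerr.bilin M a (poincareInv (Λ' t) 0 (x - E4.ofTimeSpace t (ξ t)))).bilinearComp ((((Λ' t) : E4 ≃L[ℝ] E4).symm : E4 →L[ℝ] E4)) ((deriv A t).comp ((((Λ' t) : E4 ≃L[ℝ] E4).symm : E4 →L[ℝ] E4))))‖ ≤ |M| * C * Q ^ 4 * (2 * E₁) ∧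
      (E₂ ≤ 1 → ‖P₃ x - ((fderiv ℝ (Kerr.bilin M a) (poincareInv (Λ' t) 0 (x - E4.ofTimeSpace t (ξ t))) (iteratedDeriv 2 A t (poincareInv (Λ' t) 0 (x - E4.ofTimeSpace t (ξ t))) + S t (-(iteratedDeriv 3 cc t)))).bilinearComp ((((Λ' t) : E4 ≃L[ℝ] E4).symm : E4 →L[ℝ] E4)) ((((Λ' t) : E4 ≃L[ℝ] E4).symm : E4 →L[ℝ] E4)) + (Kerr.bilin M a (poincareInv (Λ' t) 0 (x - E4.ofTimeSpace t (ξ t)))).bilinearComp ((iteratedDeriv 2 A t).comp ((((Λ' t) : E4 ≃L[ℝ] E4).symm : E4 →L[ℝ] E4))) ((((Λ' t) : E4 ≃L[ℝ] E4).symm : E4 →L[ℝ] E4)) + (Kerr.bilin M a (poincareInv (Λ' t) 0 (x - E4.ofTimeSpace t (ξ t)))).bilinearComp ((((Λ' t) : E4 ≃L[ℝ] E4).symm : E4 →L[ℝ] E4)) ((iteratedDeriv 2 A t).comp ((((Λ' t) : E4 ≃L[ℝ] E4).symm : E4 →L[ℝ] E4))))‖ ≤ |M| * C * Q ^ 4 *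 (14 * E₁)) := by
  obtain ⟨Cv, hCv0, hvar⟩ := higherOrder_variation_bounds α₀ γb R' hr₁
  obtain ⟨Cw, hCw0, hω⟩ := higherOrder_exists_omega_bounds α₀ γb R' hr₁
  refine ⟨Cv + Cw, add_nonneg hCv0 hCw0, fun Λ Λ' ξ M a Q t x hΛ's hpack hQ1 hx0 hbox ↦ ?_⟩
  intro F S A u n μ cc E₁ E₂ P₂ P₃ hE₁
  -- the package at `t`
  obtain ⟨-, hSQ, ⟨hccs, hcct, -, hcp⟩, hq₁, hq₂, -, hA, hA', -, -⟩ := hpack t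
  have hS : ContDiff ℝ ∞ S := contDiff_lorentz_symm hΛ's
  have hcct' : cc t = E4.ofTimeSpace t (ξ t) := hcct
  set z : E4 := x - cc t with hz
  have hzx : x - E4.ofTimeSpace t (ξ t) = z := by rw [hz, hcct']
  have hbox1 : (((1 : ℝ)⁻¹ * a, S t, (1 : ℝ)⁻¹ • (x - cc t)) : ℝ × (E4 →L[ℝ] E4) × E4) ∈ {p : ℝ × (E4 →L[ℝ] E4) × E4 | |p.1| ≤ α₀ ∧ ((∀ v w, Minkowski.bilin (p.2.1 v) (p.2.1 w) = Minkowski.bilin v w) ∧ |p.2.1 (E4.basisVector 0) 0| ≤ γb) ∧ ‖p.2.2‖ ≤ R' ∧ r₁ ≤ Kerr.radius p.1 (p.2.1 p.2.2)} := by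
    rw [inv_one, one_mul, one_smul, hcct']; exact hbox
  have hboxz : ((a, S t, z) : ℝ × (E4 →L[ℝ] E4) × E4) ∈ {p : ℝ × (E4 →L[ℝ] E4) × E4 | |p.1| ≤ α₀ ∧ ((∀ v w, Minkowski.bilin (p.2.1 v) (p.2.1 w) = Minkowski.bilin v w) ∧ |p.2.1 (E4.basisVector 0) 0| ≤ γb) ∧ ‖p.2.2‖ ≤ R' ∧ r₁ ≤ Kerr.radius p.1 (p.2.1 p.2.2)} := by rw [hz, hcct']; exact hbox
  -- the variation bounds with `ρ = 1`
  have hv := hvar M a 1 S cc t x le_rfl hS hccs hbox1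
  obtain ⟨-, -, ⟨c1, -, -⟩, ⟨d1, -⟩⟩ := hv
  simp only [inv_one, one_mul, one_smul, div_one] at c1 d1
  -- the summand in master-function form (`ρ = 1`)
  have hform : ∀ s w, boostedKerrBilin (Λ s) (E4.ofTimeSpace s (ξ s)) M a w = Minkowski.bilin +
      (M / 1) • (fun p : ℝ × (E4 →L[ℝ] E4) × E4 ↦ (Kerr.bilin 1 p.1 (p.2.1 p.2.2) - Minkowski.bilin).bilinearComp p.2.1 p.2.1) ((1 : ℝ)⁻¹ * a, S s, (1 : ℝ)⁻¹ • (w - cc s)) := fun s w ↦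
    higherOrder_summand_omegaForm Λ Λ' ξ cc M a one_pos (hcp M) s w
  simp only [inv_one, one_mul, one_smul, div_one] at hform
  have hP₂ : P₂ x = iteratedDeriv 2 (fun s ↦ M • (fun p : ℝ × (E4 →L[ℝ] E4) × E4 ↦ (Kerr.bilin 1 p.1 (p.2.1 p.2.2) - Minkowski.bilin).bilinearComp p.2.1 p.2.1) (a, S s, x - cc s)) t := by
    show iteratedDeriv 2 (fun s ↦ boostedKerrBilin (Λ s) (E4.ofTimeSpace s (ξ s)) M a x) t = _
    simp only [hform]
    exact iteratedDeriv_const_add (by norm_num) _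
  have hP₃ : P₃ x = iteratedDeriv 3 (fun s ↦ M • (fun p : ℝ × (E4 →L[ℝ] E4) × E4 ↦ (Kerr.bilin 1 p.1 (p.2.1 p.2.2) - Minkowski.bilin).bilinearComp p.2.1 p.2.1) (a, S s, x - cc s)) t := by
    show iteratedDeriv 3 (fun s ↦ boostedKerrBilin (Λ s) (E4.ofTimeSpace s (ξ s)) M a x) t = _
    simp only [hform]
    exact iteratedDeriv_const_add (by norm_num) _
  -- the own-term identities
  have hrad : 0 < Kerr.radius a (poincareInv (Λ' t) 0 z) := by
    have h := hboxz.2.2.2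
    have hp : poincareInv (Λ' t) 0 z = S t z := by simp only [poincareInv, sub_zero]; rfl
    rw [hp]; exact hr₁.trans_le h
  have hown := higherOrder_ownTerm Λ' hΛ's M a t (-(iteratedDeriv 2 cc t)) (-(iteratedDeriv 3 cc t)) z hrad
  obtain ⟨o2, o3, g2, g3⟩ := hown
  have o2' : M • fderiv ℝ (fun p : ℝ × (E4 →L[ℝ] E4) × E4 ↦ (Kerr.bilin 1 p.1 (p.2.1 p.2.2) - Minkowski.bilin).bilinearComp p.2.1 p.2.1) (a, S t, z) ((0 : ℝ), iteratedDeriv 2 S t, -(iteratedDeriv 2 cc t)) =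
      ((fderiv ℝ (Kerr.bilin M a) (poincareInv (Λ' t) 0 z) (deriv A t (poincareInv (Λ' t) 0 z) + S t (-(iteratedDeriv 2 cc t)))).bilinearComp ((((Λ' t) : E4 ≃L[ℝ] E4).symm : E4 →L[ℝ] E4)) ((((Λ' t) : E4 ≃L[ℝ] E4).symm : E4 →L[ℝ] E4)) + (Kerr.bilin M a (poincareInv (Λ' t) 0 z)).bilinearComp ((deriv A t).comp ((((Λ' t) : E4 ≃L[ℝ] E4).symm : E4 →L[ℝ] E4))) ((((Λ' t) : E4 ≃L[ℝ] E4).symm : E4 →L[ℝ] E4)) + (Kerr.bilin M a (poincareInv (Λ' t) 0 z)).bilinearComp ((((Λ' t) : E4 ≃L[ℝ] E4).symm : E4 →L[ℝ] E4)) ((deriv A t).comp ((((Λ' t) : E4 ≃L[ℝ] E4).symm : E4 →L[ℝ] E4)))) + M • fderiv ℝ (fun p : ℝ × (E4 →L[ℝ] E4) × E4 ↦ (Kerr.bilin 1 p.1 (p.2.1 p.2.2) - Minkowski.bilin).bilinearComp p.2.1 p.2.1) (a, S t, z) ((0 : ℝ), ((A t).comp (A t)).comp (S t), (0 : E4)) :=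 o2
  have o3' : M • fderiv ℝ (fun p : ℝ × (E4 →L[ℝ] E4) × E4 ↦ (Kerr.bilin 1 p.1 (p.2.1 p.2.2) - Minkowski.bilin).bilinearComp p.2.1 p.2.1) (a, S t, z) ((0 : ℝ), iteratedDeriv 3 S t, -(iteratedDeriv 3 cc t)) =
      ((fderiv ℝ (Kerr.bilin M a) (poincareInv (Λ' t) 0 z) (iteratedDeriv 2 A t (poincareInv (Λ' t) 0 z) + S t (-(iteratedDeriv 3 cc t)))).bilinearComp ((((Λ' t) : E4 ≃L[ℝ] E4).symm : E4 →L[ℝ] E4)) ((((Λ' t) : E4 ≃L[ℝ] E4).symm : E4 →L[ℝ] E4)) + (Kerr.bilin M a (poincareInv (Λ' t) 0 z)).bilinearComp ((iteratedDeriv 2 A t).comp ((((Λ' t) : E4 ≃L[ℝ] E4).symm : E4 →L[ℝ] E4))) ((((Λ' t) : E4 ≃L[ℝ] E4).symm : E4 →L[ℝ] E4)) + (Kerr.bilin M a (poincareInv (Λ' t) 0 z)).bilinearComp ((((Λ' t) : E4 ≃L[ℝ] E4).symm : E4 →L[ℝ] E4)) ((iteratedDeriv 2 A t).comp ((((Λ'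 t) : E4 ≃L[ℝ] E4).symm : E4 →L[ℝ] E4)))) + M • fderiv ℝ (fun p : ℝ × (E4 →L[ℝ] E4) × E4 ↦ (Kerr.bilin 1 p.1 (p.2.1 p.2.2) - Minkowski.bilin).bilinearComp p.2.1 p.2.1) (a, S t, z) ((0 : ℝ), ((2 : ℝ) • (deriv A t).comp (A t) +
        (A t).comp (deriv A t) + ((A t).comp (A t)).comp (A t)).comp (S t), (0 : E4)) := o3
  have g2' : ‖M • fderiv ℝ (fun p : ℝ × (E4 →L[ℝ] E4) × E4 ↦ (Kerr.bilin 1 p.1 (p.2.1 p.2.2) - Minkowski.bilin).bilinearComp p.2.1 p.2.1) (a, S t, z) ((0 : ℝ), ((A t).comp (A t)).comp (S t), (0 : E4))‖ ≤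
      |M| * ‖fderiv ℝ (fun p : ℝ × (E4 →L[ℝ] E4) × E4 ↦ (Kerr.bilin 1 p.1 (p.2.1 p.2.2) - Minkowski.bilin).bilinearComp p.2.1 p.2.1) (a, S t, z)‖ * ‖A t‖ ^ 2 * ‖S t‖ := g2
  have g3' : ‖M • fderiv ℝ (fun p : ℝ × (E4 →L[ℝ] E4) × E4 ↦ (Kerr.bilin 1 p.1 (p.2.1 p.2.2) - Minkowski.bilin).bilinearComp p.2.1 p.2.1) (a, S t, z) ((0 : ℝ), ((2 : ℝ) • (deriv A t).comp (A t) +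
        (A t).comp (deriv A t) + ((A t).comp (A t)).comp (A t)).comp (S t), (0 : E4))‖ ≤
      |M| * ‖fderiv ℝ (fun p : ℝ × (E4 →L[ℝ] E4) × E4 ↦ (Kerr.bilin 1 p.1 (p.2.1 p.2.2) - Minkowski.bilin).bilinearComp p.2.1 p.2.1) (a, S t, z)‖ * (3 * ‖deriv A t‖ * ‖A t‖ + ‖A t‖ ^ 3) * ‖S t‖ := g3
  -- sizes
  have hE₁0 : 0 ≤ E₁ := by positivity
  have hE₂0 : 0 ≤ E₂ := by positivity
  have hQ0 : 0 ≤ Q := zero_le_one.trans hQ1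
  have hQ14 : Q ≤ Q ^ 4 := le_self_pow₀ hQ1 (by norm_num)
  have hQ24 : Q ^ 2 ≤ Q ^ 4 := pow_le_pow_right₀ hQ1 (by norm_num)
  have hQ34 : Q ^ 3 ≤ Q ^ 4 := pow_le_pow_right₀ hQ1 (by norm_num)
  have hQ44 : 0 ≤ Q ^ 4 := by positivity
  set q₁ : ℝ := ‖deriv S t‖ + ‖deriv cc t‖ with hq₁def
  set q₂ : ℝ := ‖iteratedDeriv 2 S t‖ + ‖iteratedDeriv 2 cc t‖ with hq₂def
  have hq₁0 : 0 ≤ q₁ := by positivity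
  have hq₂0 : 0 ≤ q₂ := by positivity
  have h1 : q₁ ≤ Q * E₁ := hq₁
  have h2 : q₂ ≤ Q * (E₂ + E₁) := hq₂ hE₁
  have hq₁1 : q₁ ≤ Q := h1.trans (mul_le_of_le_one_right hQ0 hE₁)
  have hsq : q₁ ^ 2 ≤ Q ^ 2 * E₁ := by
    calc q₁ ^ 2 = q₁ * q₁ := sq q₁
      _ ≤ Q * (Q * E₁) := mul_le_mul hq₁1 h1 hq₁0 hQ0
      _ = Q ^ 2 * E₁ := by ring
  have hAn : ‖A t‖ ≤ Q * E₁ := hA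
  have hA1 : ‖A t‖ ≤ Q := hAn.trans (mul_le_of_le_one_right hQ0 hE₁)
  have hA'n : ‖deriv A t‖ ≤ Q * (E₂ + E₁) := hA' hE₁
  have hSn : ‖S t‖ ≤ Q := hSQ
  -- the derivative of the master function at the own rest position
  have hDom : ‖fderiv ℝ (fun p : ℝ × (E4 →L[ℝ] E4) × E4 ↦ (Kerr.bilin 1 p.1 (p.2.1 p.2.2) - Minkowski.bilin).bilinearComp p.2.1 p.2.1) (a, S t, z)‖ ≤ Cw := by
    rw [higherOrder_norm_fderiv_one]; exact hω _ hboxz 1 (by norm_num)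
  have hM0 : 0 ≤ |M| := abs_nonneg M
  refine ⟨?_, fun hE₂ ↦ ?_⟩
  · -- order two
    rw [hzx, hP₂]
    have hg : ‖M • fderiv ℝ (fun p : ℝ × (E4 →L[ℝ] E4) × E4 ↦ (Kerr.bilin 1 p.1 (p.2.1 p.2.2) - Minkowski.bilin).bilinearComp p.2.1 p.2.1) (a, S t, z) ((0 : ℝ), ((A t).comp (A t)).comp (S t), (0 : E4))‖ ≤
        |M| * Cw * Q ^ 3 * E₁ := by
      refine g2'.trans ?_
      calc |M| * ‖fderiv ℝ (fun p : ℝ × (E4 →L[ℝ] E4) × E4 ↦ (Kerr.bilin 1 p.1 (p.2.1 p.2.2) - Minkowski.bilin).bilinearComp p.2.1 p.2.1) (a, S t, z)‖ * ‖A t‖ ^ 2 * ‖S t‖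
          ≤ |M| * Cw * (Q * (Q * E₁)) * Q := by
            have hA2 : ‖A t‖ ^ 2 ≤ Q * (Q * E₁) := by
              rw [sq]; exact mul_le_mul hA1 hAn (norm_nonneg _) hQ0
            gcongr
        _ = |M| * Cw * Q ^ 3 * E₁ := by ring
    have hc1 : ‖iteratedDeriv 2 (fun s ↦ M • (fun p : ℝ × (E4 →L[ℝ] E4) × E4 ↦ (Kerr.bilin 1 p.1 (p.2.1 p.2.2) - Minkowski.bilin).bilinearComp p.2.1 p.2.1) (a, S s, x - cc s)) t -
        M • fderiv ℝ (fun p : ℝ × (E4 →L[ℝ] E4) × E4 ↦ (Kerr.bilin 1 p.1 (p.2.1 p.2.2) - Minkowski.bilin).bilinearComp p.2.1 p.2.1) (a, S t, z) ((0 : ℝ), iteratedDeriv 2 S t, -(iteratedDeriv 2 cc t))‖ ≤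
        |M| * Cv * q₁ ^ 2 := c1
    rw [o2'] at hc1
    have key : ‖iteratedDeriv 2 (fun s ↦ M • (fun p : ℝ × (E4 →L[ℝ] E4) × E4 ↦ (Kerr.bilin 1 p.1 (p.2.1 p.2.2) - Minkowski.bilin).bilinearComp p.2.1 p.2.1) (a, S s, x - cc s)) t - ((fderiv ℝ (Kerr.bilin M a) (poincareInv (Λ' t) 0 z) (deriv A t (poincareInv (Λ' t) 0 z) + S t (-(iteratedDeriv 2 cc t)))).bilinearComp ((((Λ' t) : E4 ≃L[ℝ] E4).symm : E4 →L[ℝ] E4)) ((((Λ' t) : E4 ≃L[ℝ] E4).symm : E4 →L[ℝ] E4)) + (Kerr.bilin M a (poincareInv (Λ' t) 0 z)).bilinearComp ((deriv A t).comp ((((Λ' t) : E4 ≃L[ℝ] E4).symm : E4 →L[ℝ] E4))) ((((Λ' t) : E4 ≃L[ℝ] E4).symm : E4 →L[ℝ] E4)) + (Kerr.bilin M a (poincareInv (Λ' t) 0 z)).bilinearComp ((((Λ' t) : E4 ≃L[ℝ] E4).symm : E4 →L[ℝ] E4)) ((deriv A t).comp ((((Λ' t) : E4 ≃L[ℝ]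 E4).symm : E4 →L[ℝ] E4))))‖ ≤
        |M| * Cv * q₁ ^ 2 + |M| * Cw * Q ^ 3 * E₁ := by
      refine le_trans ?_ (add_le_add hc1 hg)
      refine le_trans (le_of_eq ?_) (norm_add_le _ _)
      congr 1
      abel
    refine key.trans ?_
    have k1 : |M| * Cv * q₁ ^ 2 ≤ |M| * Cv * (Q ^ 4 * E₁) :=
      mul_le_mul_of_nonneg_left (hsq.trans (mul_le_mul_of_nonneg_right hQ24 hE₁0)) (by positivity)
    have k2 : |M| * Cw * Q ^ 3 * E₁ ≤ |M| * Cw * Q ^ 4 * E₁ := by gcongr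
    have k3 : 0 ≤ |M| * Cv * Q ^ 4 * E₁ := by positivity
    have k4 : 0 ≤ |M| * Cw * Q ^ 4 * E₁ := by positivity
    nlinarith only [k1, k2, k3, k4]
  · -- order three
    rw [hzx, hP₃]
    have hg : ‖M • fderiv ℝ (fun p : ℝ × (E4 →L[ℝ] E4) × E4 ↦ (Kerr.bilin 1 p.1 (p.2.1 p.2.2) - Minkowski.bilin).bilinearComp p.2.1 p.2.1) (a, S t, z) ((0 : ℝ), ((2 : ℝ) • (deriv A t).comp (A t) +
        (A t).comp (deriv A t) + ((A t).comp (A t)).comp (A t)).comp (S t), (0 : E4))‖ ≤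
        |M| * Cw * Q ^ 4 * (7 * E₁) := by
      refine g3'.trans ?_
      have hx1 : 3 * ‖deriv A t‖ * ‖A t‖ ≤ 3 * (Q * (E₂ + E₁)) * (Q * E₁) := by gcongr
      have hx2 : ‖A t‖ ^ 3 ≤ Q ^ 2 * (Q * E₁) := by
        calc ‖A t‖ ^ 3 = ‖A t‖ ^ 2 * ‖A t‖ := by ring
          _ ≤ Q ^ 2 * (Q * E₁) := mul_le_mul (pow_le_pow_left₀ (norm_nonneg _) hA1 2) hAn (norm_nonneg _) (by positivity)
      have hx3 : (E₂ + E₁) * E₁ ≤ 2 * E₁ := by nlinarith only [hE₂, hE₁, hE₁0, hE₂0]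
      calc |M| * ‖fderiv ℝ (fun p : ℝ × (E4 →L[ℝ] E4) × E4 ↦ (Kerr.bilin 1 p.1 (p.2.1 p.2.2) - Minkowski.bilin).bilinearComp p.2.1 p.2.1) (a, S t, z)‖ * (3 * ‖deriv A t‖ * ‖A t‖ + ‖A t‖ ^ 3) * ‖S t‖
          ≤ |M| * Cw * (3 * (Q * (E₂ + E₁)) * (Q * E₁) + Q ^ 2 * (Q * E₁)) * Q := by
            gcongr
        _ = |M| * Cw * Q ^ 3 * (3 * ((E₂ + E₁) * E₁)) + |M| * Cw * Q ^ 4 * E₁ := by ring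
        _ ≤ |M| * Cw * Q ^ 4 * (3 * (2 * E₁)) + |M| * Cw * Q ^ 4 * E₁ := by gcongr
        _ = |M| * Cw * Q ^ 4 * (7 * E₁) := by ring
    have hd1 : ‖iteratedDeriv 3 (fun s ↦ M • (fun p : ℝ × (E4 →L[ℝ] E4) × E4 ↦ (Kerr.bilin 1 p.1 (p.2.1 p.2.2) - Minkowski.bilin).bilinearComp p.2.1 p.2.1) (a, S s, x - cc s)) t -
        M • fderiv ℝ (fun p : ℝ × (E4 →L[ℝ] E4) × E4 ↦ (Kerr.bilin 1 p.1 (p.2.1 p.2.2) - Minkowski.bilin).bilinearComp p.2.1 p.2.1) (a, S t, z) ((0 : ℝ), iteratedDeriv 3 S t, -(iteratedDeriv 3 cc t))‖ ≤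
        |M| * Cv * (q₁ ^ 3 + 3 * q₂ * q₁) := d1
    rw [o3'] at hd1
    have key : ‖iteratedDeriv 3 (fun s ↦ M • (fun p : ℝ × (E4 →L[ℝ] E4) × E4 ↦ (Kerr.bilin 1 p.1 (p.2.1 p.2.2) - Minkowski.bilin).bilinearComp p.2.1 p.2.1) (a, S s, x - cc s)) t - ((fderiv ℝ (Kerr.bilin M a) (poincareInv (Λ' t) 0 z) (iteratedDeriv 2 A t (poincareInv (Λ' t) 0 z) + S t (-(iteratedDeriv 3 cc t)))).bilinearComp ((((Λ' t) : E4 ≃L[ℝ] E4).symm : E4 →L[ℝ] E4)) ((((Λ' t) : E4 ≃L[ℝ] E4).symm : E4 →L[ℝ] E4)) + (Kerr.bilin M a (poincareInv (Λ' t) 0 z)).bilinearComp ((iteratedDeriv 2 A t).comp ((((Λ' t) : E4 ≃L[ℝ] E4).symm : E4 →L[ℝ] E4))) ((((Λ' t) : E4 ≃L[ℝ] E4).symm : E4 →L[ℝ] E4)) + (Kerr.bilin M a (poincareInv (Λ' t) 0 z)).bilinearComp ((((Λ' t) : E4 ≃L[ℝ] E4).symm : E4 →L[ℝ] E4)) ((iteratedDeriv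 2 A t).comp ((((Λ' t) : E4 ≃L[ℝ] E4).symm : E4 →L[ℝ] E4))))‖ ≤
        |M| * Cv * (q₁ ^ 3 + 3 * q₂ * q₁) + |M| * Cw * Q ^ 4 * (7 * E₁) := by
      refine le_trans ?_ (add_le_add hd1 hg)
      refine le_trans (le_of_eq ?_) (norm_add_le _ _)
      congr 1
      abel
    refine key.trans ?_
    have hq3 : q₁ ^ 3 ≤ Q ^ 4 * E₁ := by
      calc q₁ ^ 3 = q₁ ^ 2 * q₁ := by ring
        _ ≤ (Q ^ 2 * E₁) * Q := mul_le_mul hsq hq₁1 hq₁0 (by positivity)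
        _ = Q ^ 3 * E₁ := by ring
        _ ≤ Q ^ 4 * E₁ := mul_le_mul_of_nonneg_right hQ34 hE₁0
    have hq21 : 3 * q₂ * q₁ ≤ Q ^ 4 * (6 * E₁) := by
      have j1 : q₂ * q₁ ≤ (Q * (E₂ + E₁)) * (Q * E₁) := mul_le_mul h2 h1 hq₁0 (by positivity)
      have j2 : (E₂ + E₁) * E₁ ≤ 2 * E₁ := by nlinarith only [hE₂, hE₁, hE₁0, hE₂0]
      have j3 : (Q * (E₂ + E₁)) * (Q * E₁) = Q ^ 2 * ((E₂ + E₁) * E₁) := by ring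
      rw [j3] at j1
      have j4 : Q ^ 2 * ((E₂ + E₁) * E₁) ≤ Q ^ 4 * (2 * E₁) := mul_le_mul hQ24 j2 (by positivity) hQ44
      nlinarith only [j1, j4]
    have k1 : |M| * Cv * (q₁ ^ 3 + 3 * q₂ * q₁) ≤ |M| * Cv * (Q ^ 4 * (7 * E₁)) :=
      mul_le_mul_of_nonneg_left (by nlinarith only [hq3, hq21]) (by positivity)
    have k3 : 0 ≤ |M| * Cv * Q ^ 4 * E₁ := by positivity
    have k4 : 0 ≤ |M| * Cw * Q ^ 4 * E₁ := by positivity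
    nlinarith only [k1, k3, k4]

/-- **Registered one-line carrier form** (`higherOrder_summandAt_EF`): the frozen-summand part of
`higherOrder_summandAt`. [folklore] -/
theorem higherOrder_summandAt_EF : open Literature.Geometry.Lorentzian in ∀ (α₀ γb R' : ℝ) {r₁ : ℝ}, 0 < r₁ → ∃ C : ℝ, 0 ≤ C ∧ ∀ (Λ Λ' : ℝ → lorentzGroup) (ξ : ℝ → E3) (M a Q : ℝ) (t : ℝ) (x : E4) (ρ : ℝ), ContDiff ℝ ((⊤ : ℕ∞) : WithTop ℕ∞) (fun s ↦ ((Λ' s : E4 ≃L[ℝ] E4) : E4 →L[ℝ] E4)) → (∀ t : ℝ, let F : ℝ → E4 →L[ℝ] E4 := fun s ↦ ((Λ' s : E4 ≃L[ℝ] E4) : E4 →L[ℝ] E4); let S : ℝ → E4 →L[ℝ] E4 := fun s ↦ (((Λ' s : E4 ≃L[ℝ] E4).symm : E4 ≃L[ℝ] E4) : E4 →L[ℝ] E4); let A : ℝ → E4 →L[ℝ] E4 := fun s ↦ (deriv S s).comp (F s); let u : ℝ → E4 := fun s ↦ (Λ s : E4 ≃L[ℝ] E4) (E4.basisVector 0);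 let n : ℝ → E4 := fun s ↦ (Λ s : E4 ≃L[ℝ] E4) (E4.basisVector 3); let μ : ℝ → E3 := fun s ↦ deriv ξ s - ((u s) 0)⁻¹ • E4.spatial (u s); let cc : ℝ → E4 := fun s ↦ E4.ofTimeSpace s (ξ s) - ((s - t) * (u t 0)⁻¹) • u s; let E₁ : ℝ := ‖deriv u t‖ + ‖μ t‖ + (if a = 0 then 0 else ‖deriv n t‖); let E₂ : ℝ := ‖iteratedDeriv 2 u t‖ + ‖deriv μ t‖ + (if a = 0 then 0 else ‖iteratedDeriv 2 n t‖); let E₃ : ℝ := ‖iteratedDeriv 3 u t‖ + ‖iteratedDeriv 2 μ t‖ + (if a = 0 then 0 else ‖iteratedDeriv 3 n t‖); ‖F t‖ ≤ Q ∧ ‖S t‖ ≤ Q ∧ (ContDiff ℝ ((⊤ : ℕ∞) : WithTop ℕ∞) cc ∧ cc t = E4.ofTimeSpace t (ξ t) ∧ deriv cc t = E4.spaceEmbed (μ t) ∧ ∀ (M s : ℝ) (z : E4), boostedKerrBilin (Λ s) (E4.ofTimeSpace s (ξ s)) M a z = boostedKerrBilin (Λ' s) (cc s) M a z) ∧ ‖deriv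 S t‖ + ‖deriv cc t‖ ≤ Q * E₁ ∧ (E₁ ≤ 1 → ‖iteratedDeriv 2 S t‖ + ‖iteratedDeriv 2 cc t‖ ≤ Q * (E₂ + E₁)) ∧ (E₁ ≤ 1 → E₂ ≤ 1 → ‖iteratedDeriv 3 S t‖ + ‖iteratedDeriv 3 cc t‖ ≤ Q * (E₃ + E₂ + E₁)) ∧ ‖A t‖ ≤ Q * E₁ ∧ (E₁ ≤ 1 → ‖deriv A t‖ ≤ Q * (E₂ + E₁)) ∧ (E₁ ≤ 1 → E₂ ≤ Q * ((‖deriv A t (E4.basisVector 0)‖ + ‖E4.spatial (S t (-(iteratedDeriv 2 cc t)))‖ + ‖a • deriv A t (E4.basisVector 3)‖) + E₁)) ∧ (E₁ ≤ 1 → E₂ ≤ 1 → E₃ ≤ Q * ((‖iteratedDeriv 2 A t (E4.basisVector 0)‖ + ‖E4.spatial (S t (-(iteratedDeriv 3 cc t)))‖ + ‖a • iteratedDeriv 2 A t (E4.basisVector 3)‖) + E₂ + E₁))) → 1 ≤ Q → 1 ≤ ρ → x 0 = t → ((ρ⁻¹ * a, (((Λ' t : E4 ≃L[ℝ] E4).symm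 : E4 ≃L[ℝ] E4) : E4 →L[ℝ] E4), ρ⁻¹ • (x - E4.ofTimeSpace t (ξ t))) : ℝ × (E4 →L[ℝ] E4) × E4) ∈ {p : ℝ × (E4 →L[ℝ] E4) × E4 | |p.1| ≤ α₀ ∧ ((∀ v w, Minkowski.bilin (p.2.1 v) (p.2.1 w) = Minkowski.bilin v w) ∧ |p.2.1 (E4.basisVector 0) 0| ≤ γb) ∧ ‖p.2.2‖ ≤ R' ∧ r₁ ≤ Kerr.radius p.1 (p.2.1 p.2.2)} → let u : ℝ → E4 := fun s ↦ (Λ s : E4 ≃L[ℝ] E4) (E4.basisVector 0); let n : ℝ → E4 := fun s ↦ (Λ s : E4 ≃L[ℝ] E4) (E4.basisVector 3); let μ : ℝ → E3 := fun s ↦ deriv ξ s - ((u s) 0)⁻¹ • E4.spatial (u s); let E₁ : ℝ := ‖deriv u t‖ + ‖μ t‖ + (if a = 0 then 0 else ‖deriv n t‖); E₁ ≤ 1 → ‖boostedKerrBilin (Λ t) (E4.ofTimeSpace t (ξ t)) M a x - Minkowski.bilin‖ ≤ |M| / ρ * C * Q ^ 4 ∧ ‖fderiv ℝ (fun z ↦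 boostedKerrBilin (Λ t) (E4.ofTimeSpace t (ξ t)) M a z - Minkowski.bilin) x‖ ≤ |M| / ρ * C * Q ^ 4 := by
  intro α₀ γb R' r₁ hr₁
  obtain ⟨C, hC0, h⟩ := higherOrder_summandAt α₀ γb R' hr₁
  refine ⟨C, hC0, fun Λ Λ' ξ M a Q t x ρ hΛ's hpack hQ1 hρ hx0 hbox ↦ ?_⟩
  intro u n μ E₁ hE₁
  obtain ⟨⟨h0, h1, -, -⟩, -⟩ := h Λ Λ' ξ M a Q t x ρ hΛ's hpack hQ1 hρ hx0 hbox hE₁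
  exact ⟨h0, h1⟩

end Summit.FinalStateConjecture.FinalStateConjecture.Theorems.SublinearIsFree.Slaving

end
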